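import Literature.MathematicalPhysics.QuantumLattice.ClusterProductStates
import Literature.MathematicalPhysics.QuantumLattice.ReducedResolventIntertwine
import HarnessLib

/-!
# Two-cluster slices of fermionic product states: the local Kronecker-sum Hamiltonian and the locality
# of Kato's reduced resolvent

Topic `MathematicalPhysics/QuantumLattice`; continues `ClusterProductStates.lean` (Koszul-signed product
states `⊗_c ψ_c` over an ordered partition of the orbitals into clusters; even cluster operators act on
their own factor) towards the many-cluster reduction of Kato's second-order kernel `T S(E₀) T`
(Tsai–Kivelson 2006, App. A: the `t'²` effective Hamiltonian of the checkerboard Hubbard model is a sum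
of TWO-plaquette kernels). Fix an ordered cluster partition `P`, a family of cluster vectors `ψ` (the
"environment") and two distinct clusters `c₁ ≠ c₂`.

* `prodFamily_update_update_apply`, `prodFamily_update_add/zero/smul'` — the product state is linear in
  each factor (entries);
* `sliceMap P ψ c₁ c₂ : Matrix (configurations) (Finset κ × Finset κ) ℂ` — **the two-cluster slice**: the
  linear map sending the coordinates of `a ⊗ b` (`tensorVec a b` of `InterClusterKernelIdentification`) to
  the product state with cluster `c₁` in `a`, cluster `c₂` in `b` and every other cluster in `ψ c`
  (`sliceMap_mulVec_tensorVec`); its columns are the product states of occupation basis vectors;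
* `conjTranspose_sliceMap_mul_sliceMap` — **Gram matrix across two environments**:
  `(slice ψ')ᴴ (slice ψ) = (Π_{c ∉ {c₁,c₂}} ⟨ψ' c, ψ c⟩) • 1`; in particular a slice over unit
  environment vectors is an ISOMETRY, and slices over environments differing in an orthogonal factor have
  orthogonal ranges (`star_sliceMap_mulVec_dotProduct_sliceMap_mulVec`);
* `sum_jwEmbed_mul_sliceMap` — **the local Hamiltonian is the Kronecker sum**: if `A c` are even cluster
  operators and the environment vectors are eigenvectors, `A c (ψ c) = E c · ψ c` (`c ∉ {c₁,c₂}`), then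
  `(Σ_c jwEmbed (emb c) (A c)) · slice = slice · (A c₁ ⊗ 1 + 1 ⊗ A c₂) + (Σ_{c ∉ {c₁,c₂}} E c) · slice`;
* `reducedResolvent_mulVec_sliceMap_mulVec` — hence (by `ReducedResolventIntertwine`) Kato's reduced resolvent
  of `H_in = Σ_c jwEmbed (A c)` at `E` acts on the slice as the reduced resolvent of the Kronecker sum at the
  LOCAL energy `E − Σ_{env} E c`: `S_{H_in}(E) (slice v) = slice (S_{A₁ ⊗ 1 + 1 ⊗ A₂}(E − E_env) v)`, and
  its matrix elements between two slices are the two-cluster ones times the environment overlap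
  (`star_sliceMap_mulVec_dotProduct_reducedResolvent_sliceMap_mulVec`).

With `pairResolvent_eq_dotProduct_reducedResolvent_kroneckerSum` this turns matrix elements of
`S_{H_in}(E₀)` between "two-excited" product states into pair resolvents of ONE cluster Hamiltonian — the
linear-algebra heart of clause (d) of the plaquette-boson dictionary.

Tree: `ClusterProduct.Partition.prodFamily`, `prodFamily_apply`, `star_prodFamily_dotProduct_prodFamily`,
`jwEmbed_mulVec_prodFamily`, `koszul_mul_self` (`ClusterProductStates`); `tensorVec`, `kroneckerSum`,
`kroneckerSum_mulVec_tensorVec`, `isHermitian_kroneckerSum` (`InterClusterKernelIdentification`);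
`reducedResolvent_mulVec_of_intertwine_shift` (`ReducedResolventIntertwine`). Mathlib: `Matrix.mulVec_single_one`,
`Function.update_comm`, `Finset.prod_erase_mul`.

References: W.-F. Tsai, S. A. Kivelson, PRB 73 (2006) 214510, App. A (A1) [TsaiKivelson2006]; T. Kato (1966),
I-§5.3 (5.32) [Kato1966]; N. Bultinck, D. J. Williamson, J. Haegeman, F. Verstraete, PRB 95 (2017) 075108,
§IV.A [BultinckWilliamsonHaegemanVerstraete2017fMPS].
-/

noncomputable section

namespace Literature.MathematicalPhysics.QuantumLattice

open Matrix Finset TwoCluster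

namespace ClusterProduct.Partition

variable {ι' C κ : Type*} [LinearOrder ι'] [LinearOrder C] [LinearOrder κ] (P : Partition ι' C κ)

/-! ### Linearity of the product state in each factor -/

section Linearity

variable [Fintype C]

/-- Entries of a product state with two prescribed factors: for `c₁ ≠ c₂`,
`(⊗(ψ; c₁ ↦ a, c₂ ↦ b))(s) = koszul(s) · a(s_{c₁}) · b(s_{c₂}) · Π_{c ∉ {c₁,c₂}} ψ_c(s_c)`. [folklore] -/
theorem prodFamily_update_update_apply {c₁ c₂ : C} (h : c₁ ≠ c₂) (ψ : C → Fock κ) (a b : Fock κ)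
    (s : Finset ι') :
    P.prodFamily (Function.update (Function.update ψ c₁ a) c₂ b) s =
      P.koszul s * (a (P.part c₁ s) * b (P.part c₂ s)) *
        ∏ c ∈ (Finset.univ.erase c₁).erase c₂, ψ c (P.part c s) := by
  rw [prodFamily_apply, ← Finset.mul_prod_erase _ _ (Finset.mem_univ c₁),
    ← Finset.mul_prod_erase _ _ (Finset.mem_erase.2 ⟨fun h' => h h'.symm, Finset.mem_univ c₂⟩),
    Function.update_of_ne h, Function.update_self, Function.update_self]
  have hrest : ∏ c ∈ (Finset.univ.erase c₁).erase c₂, Function.update (Function.update ψ c₁ a) c₂ b c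
      (P.part c s) = ∏ c ∈ (Finset.univ.erase c₁).erase c₂, ψ c (P.part c s) := by
    refine Finset.prod_congr rfl fun c hc => ?_
    rw [Function.update_of_ne (Finset.ne_of_mem_erase hc),
      Function.update_of_ne (Finset.ne_of_mem_erase (Finset.mem_of_mem_erase hc))]
  rw [hrest]
  ring

/-- The product state is additive in each factor. [folklore] -/
theorem prodFamily_update_add [DecidableEq C] (ψ : C → Fock κ) (c₀ : C) (x y : Fock κ) :
    P.prodFamily (Function.update ψ c₀ (x + y)) =
      P.prodFamily (Function.update ψ c₀ x) + P.prodFamily (Function.update ψ c₀ y) := by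
  funext s
  simp only [Pi.add_apply, prodFamily_apply]
  rw [← Finset.mul_prod_erase _ _ (Finset.mem_univ c₀), ← Finset.mul_prod_erase Finset.univ
      (fun c => Function.update ψ c₀ x c (P.part c s)) (Finset.mem_univ c₀),
    ← Finset.mul_prod_erase Finset.univ (fun c => Function.update ψ c₀ y c (P.part c s)) (Finset.mem_univ c₀)]
  simp only [Function.update_self, Pi.add_apply]
  have h : ∀ z : Fock κ, ∏ c ∈ Finset.univ.erase c₀, Function.update ψ c₀ z c (P.part c s) =
      ∏ c ∈ Finset.univ.erase c₀, ψ c (P.part c s) := fun z =>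
    Finset.prod_congr rfl fun c hc => by rw [Function.update_of_ne (Finset.ne_of_mem_erase hc)]
  rw [h, h, h]
  ring

/-- The product state vanishes if one factor does. [folklore] -/
theorem prodFamily_update_zero [DecidableEq C] (ψ : C → Fock κ) (c₀ : C) :
    P.prodFamily (Function.update ψ c₀ 0) = 0 := by
  funext s
  rw [prodFamily_apply, ← Finset.mul_prod_erase _ _ (Finset.mem_univ c₀), Function.update_self,
    Pi.zero_apply, Pi.zero_apply, zero_mul, mul_zero]

/-- The product state is homogeneous in each factor. [folklore] -/
theorem prodFamily_update_smul' [DecidableEq C] (ψ : C → Fock κ) (c₀ : C) (r : ℂ) (x : Fock κ) :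
    P.prodFamily (Function.update ψ c₀ (r • x)) = r • P.prodFamily (Function.update ψ c₀ x) := by
  funext s
  rw [Pi.smul_apply, prodFamily_apply, prodFamily_apply, ← Finset.mul_prod_erase _ _ (Finset.mem_univ c₀),
    ← Finset.mul_prod_erase Finset.univ (fun c => Function.update ψ c₀ x c (P.part c s)) (Finset.mem_univ c₀)]
  simp only [Function.update_self, Pi.smul_apply, smul_eq_mul]
  have h : ∀ z : Fock κ, ∏ c ∈ Finset.univ.erase c₀, Function.update ψ c₀ z c (P.part c s) =
      ∏ c ∈ Finset.univ.erase c₀, ψ c (P.part c s) := fun z =>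
    Finset.prod_congr rfl fun c hc => by rw [Function.update_of_ne (Finset.ne_of_mem_erase hc)]
  rw [h, h]
  ring

end Linearity

/-! ### The two-cluster slice -/

section Slice

variable [Fintype ι'] [Fintype C] [Fintype κ]

/-- **The two-cluster slice of the product states.** For an environment `ψ` and clusters `c₁, c₂`, the
linear map from the coordinates of `Fock κ ⊗ Fock κ` (functions on `Finset κ × Finset κ`) to the big Fock
space whose column at `(w₁, w₂)` is the product state with cluster `c₁` in the basis vector `|w₁⟩`,
cluster `c₂` in `|w₂⟩` and every other cluster `c` in `ψ c`. [cite: TsaiKivelson2006, App. A (A1)] -/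
def sliceMap (ψ : C → Fock κ) (c₁ c₂ : C) : Matrix (Finset ι') (Finset κ × Finset κ) ℂ :=
  Matrix.of fun s p =>
    P.prodFamily (Function.update (Function.update ψ c₁ (Pi.single p.1 1)) c₂ (Pi.single p.2 1)) s

omit [Fintype ι'] in
/-- **The slice sends `a ⊗ b` to the product state with factors `a`, `b` at `c₁`, `c₂`.**
[cite: TsaiKivelson2006, App. A (A1)] -/
theorem sliceMap_mulVec_tensorVec {c₁ c₂ : C} (h : c₁ ≠ c₂) (ψ : C → Fock κ) (a b : Fock κ) :
    P.sliceMap ψ c₁ c₂ *ᵥ tensorVec a b = P.prodFamily (Function.update (Function.update ψ c₁ a) c₂ b) := by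
  funext s
  rw [mulVec, dotProduct, P.prodFamily_update_update_apply h]
  simp only [sliceMap, Matrix.of_apply, P.prodFamily_update_update_apply h, tensorVec_apply]
  -- only the column `(s_{c₁}, s_{c₂})` contributes
  rw [Finset.sum_eq_single (P.part c₁ s, P.part c₂ s)]
  · simp only [Pi.single_eq_same]
    ring
  · rintro ⟨w₁, w₂⟩ _ hw
    have : (Pi.single w₁ (1 : ℂ) : Fock κ) (P.part c₁ s) * (Pi.single w₂ (1 : ℂ) : Fock κ) (P.part c₂ s) = 0 := by
      by_cases h1 : w₁ = P.part c₁ s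
      · have h2 : w₂ ≠ P.part c₂ s := fun h2 => hw (Prod.ext h1 h2)
        rw [Pi.single_eq_of_ne' h2, mul_zero]
      · rw [Pi.single_eq_of_ne' h1, zero_mul]
    rw [this]
    ring
  · exact fun hs => absurd (Finset.mem_univ _) hs

omit [LinearOrder ι'] [LinearOrder C] [Fintype ι'] [Fintype C] [Fintype κ] P in
/-- A basis vector of the product index type is a product of basis vectors. [folklore] -/
theorem single_eq_tensorVec_single (p : Finset κ × Finset κ) :
    (Pi.single p (1 : ℂ) : Finset κ × Finset κ → ℂ) = tensorVec (Pi.single p.1 1) (Pi.single p.2 1) := by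
  funext q
  rw [tensorVec_apply]
  by_cases hq : q = p
  · rw [hq, Pi.single_eq_same, Pi.single_eq_same, Pi.single_eq_same, mul_one]
  · rw [Pi.single_eq_of_ne hq]
    by_cases h1 : q.1 = p.1
    · have h2 : q.2 ≠ p.2 := fun h2 => hq (Prod.ext h1 h2)
      rw [Pi.single_eq_of_ne h2, mul_zero]
    · rw [Pi.single_eq_of_ne h1, zero_mul]

omit [Fintype ι'] in
/-- The columns of the slice. [folklore] -/
theorem sliceMap_mulVec_single {c₁ c₂ : C} (h : c₁ ≠ c₂) (ψ : C → Fock κ) (p : Finset κ × Finset κ) :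
    P.sliceMap ψ c₁ c₂ *ᵥ Pi.single p 1 =
      P.prodFamily (Function.update (Function.update ψ c₁ (Pi.single p.1 1)) c₂ (Pi.single p.2 1)) := by
  rw [single_eq_tensorVec_single, P.sliceMap_mulVec_tensorVec h]

/-- **Gram matrices of slices across two environments**: for `c₁ ≠ c₂`,
`(slice ψ')ᴴ (slice ψ) = (Π_{c ∉ {c₁,c₂}} ⟨ψ' c, ψ c⟩) • 1` — columns over the same basis pair overlap
through the environments only, columns over different basis pairs are orthogonal.
[cite: TsaiKivelson2006, App. A (A1)] -/
theorem conjTranspose_sliceMap_mul_sliceMap {c₁ c₂ : C} (h : c₁ ≠ c₂) (ψ' ψ : C → Fock κ) :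
    (P.sliceMap ψ' c₁ c₂)ᴴ * P.sliceMap ψ c₁ c₂ =
      (∏ c ∈ (Finset.univ.erase c₁).erase c₂, star (ψ' c) ⬝ᵥ ψ c) •
        (1 : Matrix (Finset κ × Finset κ) (Finset κ × Finset κ) ℂ) := by
  ext p' p
  have hcol : ∀ (φ : C → Fock κ) (q : Finset κ × Finset κ) (s : Finset ι'), P.sliceMap φ c₁ c₂ s q =
      P.prodFamily (Function.update (Function.update φ c₁ (Pi.single q.1 1)) c₂ (Pi.single q.2 1)) s :=
    fun φ q s => rfl
  rw [Matrix.mul_apply]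
  simp only [conjTranspose_apply, hcol]
  rw [show ∑ s, star (P.prodFamily (Function.update (Function.update ψ' c₁ (Pi.single p'.1 1)) c₂
      (Pi.single p'.2 1)) s) * P.prodFamily (Function.update (Function.update ψ c₁ (Pi.single p.1 1)) c₂
        (Pi.single p.2 1)) s =
      star (P.prodFamily (Function.update (Function.update ψ' c₁ (Pi.single p'.1 1)) c₂ (Pi.single p'.2 1))) ⬝ᵥ
        P.prodFamily (Function.update (Function.update ψ c₁ (Pi.single p.1 1)) c₂ (Pi.single p.2 1)) from rfl,
    P.star_prodFamily_dotProduct_prodFamily, ← Finset.mul_prod_erase _ _ (Finset.mem_univ c₁),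
    ← Finset.mul_prod_erase _ _ (Finset.mem_erase.2 ⟨fun h' => h h'.symm, Finset.mem_univ c₂⟩)]
  simp only [Function.update_self, Function.update_of_ne h]
  have hrest : ∏ c ∈ (Finset.univ.erase c₁).erase c₂,
      star (Function.update (Function.update ψ' c₁ (Pi.single p'.1 1)) c₂ (Pi.single p'.2 1) c) ⬝ᵥ
        Function.update (Function.update ψ c₁ (Pi.single p.1 1)) c₂ (Pi.single p.2 1) c =
      ∏ c ∈ (Finset.univ.erase c₁).erase c₂, star (ψ' c) ⬝ᵥ ψ c := by
    refine Finset.prod_congr rfl fun c hc => ?_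
    have hc₂ : c ≠ c₂ := Finset.ne_of_mem_erase hc
    have hc₁ : c ≠ c₁ := Finset.ne_of_mem_erase (Finset.mem_of_mem_erase hc)
    rw [Function.update_of_ne hc₂, Function.update_of_ne hc₁, Function.update_of_ne hc₂,
      Function.update_of_ne hc₁]
  rw [hrest, Matrix.smul_apply, Matrix.one_apply, smul_eq_mul]
  -- the two basis-vector overlaps
  have hδ : ∀ w' w : Finset κ, star (Pi.single w' (1 : ℂ) : Fock κ) ⬝ᵥ (Pi.single w (1 : ℂ) : Fock κ) =
      if w' = w then 1 else 0 := by
    intro w' w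
    rw [dotProduct_single, mul_one, Pi.star_apply, Pi.single_apply]
    by_cases hw : w' = w
    · rw [if_pos hw.symm, if_pos hw, star_one]
    · rw [if_neg (fun h' => hw h'.symm), if_neg hw, star_zero]
  rw [hδ, hδ]
  by_cases hp : p' = p
  · subst hp
    rw [if_pos rfl, if_pos rfl, if_pos rfl]
    ring
  · rw [if_neg hp]
    by_cases h1 : p'.1 = p.1
    · have h2 : p'.2 ≠ p.2 := fun h2 => hp (Prod.ext h1 h2)
      rw [if_neg h2]
      ring
    · rw [if_neg h1]
      ring

/-- **Inner products between vectors of two slices** (vector form of the Gram identity):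
`⟨slice ψ' v', slice ψ v⟩ = (Π_{c ∉ {c₁,c₂}} ⟨ψ' c, ψ c⟩) · ⟨v', v⟩`. [cite: TsaiKivelson2006, App. A (A1)] -/
theorem star_sliceMap_mulVec_dotProduct_sliceMap_mulVec {c₁ c₂ : C} (h : c₁ ≠ c₂) (ψ' ψ : C → Fock κ)
    (v' v : Finset κ × Finset κ → ℂ) :
    star (P.sliceMap ψ' c₁ c₂ *ᵥ v') ⬝ᵥ (P.sliceMap ψ c₁ c₂ *ᵥ v) =
      (∏ c ∈ (Finset.univ.erase c₁).erase c₂, star (ψ' c) ⬝ᵥ ψ c) * (star v' ⬝ᵥ v) := by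
  rw [star_mulVec, ← dotProduct_mulVec, mulVec_mulVec, P.conjTranspose_sliceMap_mul_sliceMap h,
    smul_mulVec, one_mulVec, dotProduct_smul, smul_eq_mul]

/-- A slice over UNIT environment vectors is an isometry. [folklore] -/
theorem conjTranspose_sliceMap_mul_self {c₁ c₂ : C} (h : c₁ ≠ c₂) {ψ : C → Fock κ}
    (hψ : ∀ c, c ≠ c₁ → c ≠ c₂ → star (ψ c) ⬝ᵥ ψ c = 1) :
    (P.sliceMap ψ c₁ c₂)ᴴ * P.sliceMap ψ c₁ c₂ = 1 := by
  rw [P.conjTranspose_sliceMap_mul_sliceMap h, Finset.prod_eq_one, one_smul]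
  intro c hc
  exact hψ c (Finset.ne_of_mem_erase (Finset.mem_of_mem_erase hc)) (Finset.ne_of_mem_erase hc)

/-! ### The local Hamiltonian on a slice is the Kronecker sum -/

/-- **On a two-cluster slice, a sum of even cluster operators acts as the Kronecker sum of the two
local operators plus the environment eigenvalues**: if every `A c` is parity preserving and the
environment vectors are eigenvectors, `A c (ψ c) = E c · ψ c` for `c ∉ {c₁, c₂}`, then
`(Σ_c jwEmbed (emb c) (A c)) · slice = slice · (A c₁ ⊗ 1 + 1 ⊗ A c₂) + (Σ_{c ∉ {c₁,c₂}} E c) · slice`.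
[cite: TsaiKivelson2006, App. A (A1)] -/
theorem sum_jwEmbed_mul_sliceMap {c₁ c₂ : C} (h : c₁ ≠ c₂) {A : C → Matrix (Finset κ) (Finset κ) ℂ}
    (hA : ∀ c, IsParityPreserving (A c)) (ψ : C → Fock κ) {E : C → ℂ}
    (hψ : ∀ c, c ≠ c₁ → c ≠ c₂ → A c *ᵥ ψ c = E c • ψ c) :
    (∑ c, jwEmbed (P.emb c) (A c)) * P.sliceMap ψ c₁ c₂ =
      P.sliceMap ψ c₁ c₂ * kroneckerSum (A c₁) (A c₂) +
        (∑ c ∈ (Finset.univ.erase c₁).erase c₂, E c) • P.sliceMap ψ c₁ c₂ := by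
  -- compare the two sides column by column
  have hcol : ∀ p : Finset κ × Finset κ,
      ((∑ c, jwEmbed (P.emb c) (A c)) * P.sliceMap ψ c₁ c₂) *ᵥ Pi.single p 1 =
        (P.sliceMap ψ c₁ c₂ * kroneckerSum (A c₁) (A c₂) +
          (∑ c ∈ (Finset.univ.erase c₁).erase c₂, E c) • P.sliceMap ψ c₁ c₂) *ᵥ Pi.single p 1 := by
    intro p
    set e₁ : Fock κ := Pi.single p.1 1 with he₁
    set e₂ : Fock κ := Pi.single p.2 1 with he₂
    set Ψ : C → Fock κ := Function.update (Function.update ψ c₁ e₁) c₂ e₂ with hΨ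
    have hΨ₁ : Ψ c₁ = e₁ := by rw [hΨ, Function.update_of_ne h, Function.update_self]
    have hΨ₂ : Ψ c₂ = e₂ := by rw [hΨ, Function.update_self]
    have hΨc : ∀ c, c ≠ c₁ → c ≠ c₂ → Ψ c = ψ c := fun c hc₁ hc₂ => by
      rw [hΨ, Function.update_of_ne hc₂, Function.update_of_ne hc₁]
    have hcolΨ : P.sliceMap ψ c₁ c₂ *ᵥ Pi.single p 1 = P.prodFamily Ψ := P.sliceMap_mulVec_single h ψ p
    have hc₂mem : c₂ ∈ Finset.univ.erase c₁ := Finset.mem_erase.2 ⟨fun h' => h h'.symm, Finset.mem_univ c₂⟩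
    -- left-hand side: each embedded operator acts on its own factor
    rw [← mulVec_mulVec, hcolΨ, sum_mulVec, ← Finset.add_sum_erase _ _ (Finset.mem_univ c₁),
      ← Finset.add_sum_erase _ _ hc₂mem, P.jwEmbed_mulVec_prodFamily (hA c₁),
      P.jwEmbed_mulVec_prodFamily (hA c₂), hΨ₁, hΨ₂]
    have hrest : ∑ c ∈ (Finset.univ.erase c₁).erase c₂, jwEmbed (P.emb c) (A c) *ᵥ P.prodFamily Ψ =
        ∑ c ∈ (Finset.univ.erase c₁).erase c₂, E c • P.prodFamily Ψ := by
      refine Finset.sum_congr rfl fun c hc => ?_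
      have hc₂ : c ≠ c₂ := Finset.ne_of_mem_erase hc
      have hc₁ : c ≠ c₁ := Finset.ne_of_mem_erase (Finset.mem_of_mem_erase hc)
      rw [P.jwEmbed_mulVec_prodFamily (hA c), hΨc c hc₁ hc₂, hψ c hc₁ hc₂, ← hΨc c hc₁ hc₂,
        P.prodFamily_update_smul', Function.update_eq_self]
    have hu₁ : Function.update Ψ c₁ (A c₁ *ᵥ e₁) = Function.update (Function.update ψ c₁ (A c₁ *ᵥ e₁)) c₂ e₂ := by
      rw [hΨ, Function.update_comm (Ne.symm h), Function.update_idem]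
    have hu₂ : Function.update Ψ c₂ (A c₂ *ᵥ e₂) = Function.update (Function.update ψ c₁ e₁) c₂ (A c₂ *ᵥ e₂) := by
      rw [hΨ, Function.update_idem]
    rw [hrest, hu₁, hu₂, ← P.sliceMap_mulVec_tensorVec h, ← P.sliceMap_mulVec_tensorVec h, ← Finset.sum_smul]
    -- right-hand side
    rw [add_mulVec, smul_mulVec, hcolΨ, ← mulVec_mulVec, single_eq_tensorVec_single,
      kroneckerSum_mulVec_tensorVec, mulVec_add, P.sliceMap_mulVec_tensorVec h, ← he₁, ← he₂, add_assoc]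
  ext s p
  have h1 := congrFun (hcol p) s
  rwa [mulVec_single_one, mulVec_single_one, col_apply, col_apply] at h1

/-! ### Locality of Kato's reduced resolvent on a slice -/

/-- **LOCALITY OF THE REDUCED RESOLVENT ON A TWO-CLUSTER SLICE.** Let `H_in = Σ_c jwEmbed (emb c) (A c)` be a
sum of even Hermitian cluster operators and let the environment vectors be eigenvectors,
`A c (ψ c) = E c · ψ c` (`c ∉ {c₁,c₂}`, real `E c`). Then on the slice Kato's reduced resolvent of `H_in` at
`E₀` IS the reduced resolvent of the two-cluster Kronecker sum `A c₁ ⊗ 1 + 1 ⊗ A c₂` at the local energy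
`E₀ − Σ_{c ∉ {c₁,c₂}} E c`: `S_{H_in}(E₀) (slice v) = slice (S_loc(E₀ − E_env) v)`.
[cite: Kato1966, I-§5.3 (5.32)] -/
theorem reducedResolvent_mulVec_sliceMap_mulVec {c₁ c₂ : C} (h : c₁ ≠ c₂)
    {A : C → Matrix (Finset κ) (Finset κ) ℂ} (hA : ∀ c, IsParityPreserving (A c))
    (hAh : ∀ c, (A c).IsHermitian) {Hin : Matrix (Finset ι') (Finset ι') ℂ} (hHin : Hin.IsHermitian)
    (hsum : Hin = ∑ c, jwEmbed (P.emb c) (A c)) (ψ : C → Fock κ) {E : C → ℝ}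
    (hψ : ∀ c, c ≠ c₁ → c ≠ c₂ → A c *ᵥ ψ c = ((E c : ℝ) : ℂ) • ψ c) (E₀ : ℝ)
    (v : Finset κ × Finset κ → ℂ) :
    reducedResolvent Hin E₀ *ᵥ (P.sliceMap ψ c₁ c₂ *ᵥ v) =
      P.sliceMap ψ c₁ c₂ *ᵥ (reducedResolvent (kroneckerSum (A c₁) (A c₂))
        (E₀ - ∑ c ∈ (Finset.univ.erase c₁).erase c₂, E c) *ᵥ v) := by
  have hW : Hin * P.sliceMap ψ c₁ c₂ = P.sliceMap ψ c₁ c₂ * kroneckerSum (A c₁) (A c₂) +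
      (((∑ c ∈ (Finset.univ.erase c₁).erase c₂, E c : ℝ)) : ℂ) • P.sliceMap ψ c₁ c₂ := by
    rw [hsum, P.sum_jwEmbed_mul_sliceMap h hA ψ hψ, Complex.ofReal_sum]
  exact reducedResolvent_mulVec_of_intertwine_shift hHin (isHermitian_kroneckerSum (hAh c₁) (hAh c₂)) hW E₀ v

/-- **Matrix elements of the reduced resolvent between two slices** (possibly over different
environments `ψ'`, `ψ`; the ket environment consists of eigenvectors): the two-cluster matrix element at
the local energy times the environment overlap,
`⟨slice ψ' v', S_{H_in}(E₀) slice ψ v⟩ = (Π_{c ∉ {c₁,c₂}} ⟨ψ' c, ψ c⟩) · ⟨v', S_loc(E₀ − E_env) v⟩`.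
[cite: TsaiKivelson2006, App. A (A1)] -/
theorem star_sliceMap_mulVec_dotProduct_reducedResolvent_sliceMap_mulVec {c₁ c₂ : C} (h : c₁ ≠ c₂)
    {A : C → Matrix (Finset κ) (Finset κ) ℂ} (hA : ∀ c, IsParityPreserving (A c))
    (hAh : ∀ c, (A c).IsHermitian) {Hin : Matrix (Finset ι') (Finset ι') ℂ} (hHin : Hin.IsHermitian)
    (hsum : Hin = ∑ c, jwEmbed (P.emb c) (A c)) (ψ' ψ : C → Fock κ) {E : C → ℝ}
    (hψ : ∀ c, c ≠ c₁ → c ≠ c₂ → A c *ᵥ ψ c = ((E c : ℝ) : ℂ) • ψ c) (E₀ : ℝ)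
    (v' v : Finset κ × Finset κ → ℂ) :
    star (P.sliceMap ψ' c₁ c₂ *ᵥ v') ⬝ᵥ (reducedResolvent Hin E₀ *ᵥ (P.sliceMap ψ c₁ c₂ *ᵥ v)) =
      (∏ c ∈ (Finset.univ.erase c₁).erase c₂, star (ψ' c) ⬝ᵥ ψ c) *
        (star v' ⬝ᵥ (reducedResolvent (kroneckerSum (A c₁) (A c₂))
          (E₀ - ∑ c ∈ (Finset.univ.erase c₁).erase c₂, E c) *ᵥ v)) := by
  rw [P.reducedResolvent_mulVec_sliceMap_mulVec h hA hAh hHin hsum ψ hψ E₀ v,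
    P.star_sliceMap_mulVec_dotProduct_sliceMap_mulVec h]

end Slice

end ClusterProduct.Partition

end Literature.MathematicalPhysics.QuantumLattice

end
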